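import Mathlib
import Summits.Ventures.PercRepro2.PMK5Deg3Kernel
import Summits.Ventures.PercRepro2.PMK5Deg4Kernel

/-!
# The five-digit slice certificates of the typed `K₃` base on `K₅ + a₃` of degree 4 — the definitions
(blind cell PercRepro2, mine-2 g28; the design that fits the farm kernel's memory cap for the degree-4 rung of
Theorem 28: `PMK5Deg4Kernel.lean` (the graph, the nineteen tables) with FIVE sliced digits instead of three)

**Why five digits.** With the three `a₃`-digits sliced (`PMK5Deg4Kernel.lean`), a slice whose three digits all lie in
`{1, 2}` needs, in one kernel evaluation, `152` eleven-edge literal trees (≈ `4.1` GB of retained intermediates) and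
`213` products of `4^11`-digit numbers per sign (≈ `2.9` GB): the farm kernel's memory cap (≈ `5.7` GB, g27's
«excessive memory consumption») kills it at ≈ `215` s, while the slices with a digit in `{0, 3}` pass.  Slicing the
LAST FIVE edges `9, 10, 11, 12, 13` (the base edge `u b = 9` and the four `a₃`-edges) leaves nine-edge numbers
(`4^9` digits of `26` bits, `0.85` MB): the heaviest of the `4^5 = 1024` slices retains ≈ `1.0` GB of literal trees
(`608` nine-edge literals), ≈ `1.5` GB of products and ≈ `1.2` GB of bracket sums — under the cap with margin —
and the total farm work is unchanged (the products shrink by the factor by which their number grows).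

**The objects.** A profile `k : Fin 14 → Fin 4` is `(k', j₁, …, j₅)` with `k'` on the nine edges `0..8` and `j_i` the
digit of the edge `8 + i`; the class sum at `k` is the sum over the three-bit splittings of the five digits of the
nine-edge triple counts of the tables restricted by `res5` / `ext5` (proved in `Deg4Slices5.lean`).  Each slice is a
`4^9`-digit certificate (`kPosS`, `kNegS`, `CertS`) in the base `KB = 2^26` (a slice digit is at most
`10 · 3^14 = 47,829,690 < 2^26`), the products grouped by the first factor as in the degree-3 file; the restricted
tables enter as `512`-bit literals `L : Fin 19 → Bool → Bool → Bool → Bool → Bool → ℕ` (`LitOK`, `bits9` / `goB`)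
whose Kronecker numbers the kernel takes by the index-carrying tree `goL`.  A quadruple's certificate is
`LitOK x y z w L` plus `Cert L` (the `1024` slices `CertS L j₁ j₂ j₃ j₄ j₅`); `Deg4Typed5.HCov_deg4` turns it into row
2′TRI and (HCOV) on `K₅ + {a₃x, a₃y, a₃z, a₃w}` for every weight vector.  No `native_decide`.
-/

namespace Summit.Ventures.PercRepro2

namespace Deg4

namespace Five

/-! ## Restriction of the five edges `9, …, 13`: tables on the nine remaining edges -/

/-- Extend a nine-edge configuration by the states `a, b, c, d, e` of the edges `9, 10, 11, 12, 13`. -/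
def ext5 (ω : Fin 9 → Bool) (a b c d e : Bool) : Fin 14 → Bool :=
  fun f => if h : (f : ℕ) < 9 then ω ⟨f, h⟩ else if (f : ℕ) = 9 then a else if (f : ℕ) = 10 then b
    else if (f : ℕ) = 11 then c else if (f : ℕ) = 12 then d else e

/-- The restriction of a fourteen-edge table to the nine-edge configurations, edges `9, …, 13` fixed. -/
def res5 (T : (Fin 14 → Bool) → Bool) (a b c d e : Bool) : (Fin 9 → Bool) → Bool :=
  fun ω => T (ext5 ω a b c d e)

/-! ## Bit vectors of nine-edge tables (the certificate's table literals) -/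

/-- The binary index of a nine-edge configuration: bit `e` is the state of edge `e`. -/
def idx2 (ω : Fin 9 → Bool) : ℕ := ∑ e, (ω e).toNat * 2 ^ (e : ℕ)

/-- The bit vector of a table, as a finite sum: bit `idx2 ω` is `T ω`. -/
def bitsSum (T : (Fin 9 → Bool) → Bool) : ℕ := ∑ ω, (T ω).toNat * 2 ^ idx2 ω

/-- The same by the edge tree (`goB T n ω` over the states of the edges `< n`, the others fixed by `ω`). -/
def goB (T : (Fin 9 → Bool) → Bool) : ℕ → (Fin 9 → Bool) → ℕ
  | 0, ω => (T ω).toNat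
  | n + 1, ω => goB T n (Function.update ω (Fin.ofNat 9 n) false) +
      2 ^ (2 ^ n) * goB T n (Function.update ω (Fin.ofNat 9 n) true)

/-- The bit vector of a nine-edge table, kernel form (`512` bits). -/
def bits9 (T : (Fin 9 → Bool) → Bool) : ℕ := goB T 9 (fun _ => false)

/-- **The table literals of a quadruple are correct**: `L i a b c d e` is the bit vector of the restriction of the
`i`-th table of the quadruple to edges `9 ↦ a`, `10 ↦ b`, `11 ↦ c`, `12 ↦ d`, `13 ↦ e`. -/
def LitOK (x y z w : Fin 5) (L : Fin 19 → Bool → Bool → Bool → Bool → Bool → ℕ) : Prop :=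
  ∀ (i : Fin 19) (a b c d e : Bool), L i a b c d e = bits9 (res5 (tab x y z w i) a b c d e)

/-! ## Kronecker numbers on nine edges in the base `2^26` -/

/-- The base-4 index of a nine-edge configuration: digit `e` is the state of edge `e`. -/
def idx (ω : Fin 9 → Bool) : ℕ := ∑ e, (ω e).toNat * 4 ^ (e : ℕ)

/-- The Kronecker base `2^26` (a slice digit is a sum of at most `10 · 243` counts `≤ 3^9`, so `< 2^26`). -/
def KB : ℕ := 2 ^ 26

/-- The Kronecker encoding of a Boolean table on the nine-edge configurations, as a finite sum. -/
def kronSum (T : (Fin 9 → Bool) → Bool) : ℕ := ∑ ω, (T ω).toNat * KB ^ idx ω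

/-- The same number by a binary tree over the edges `8, …, 0`. -/
def go (T : (Fin 9 → Bool) → Bool) : ℕ → (Fin 9 → Bool) → ℕ
  | 0, ω => (T ω).toNat
  | n + 1, ω => go T n (Function.update ω (Fin.ofNat 9 n) false) +
      KB ^ (4 ^ n) * go T n (Function.update ω (Fin.ofNat 9 n) true)

/-- The Kronecker encoding, kernel form: `kron T = go T 9 (fun _ => false)`. -/
def kron (T : (Fin 9 → Bool) → Bool) : ℕ := go T 9 (fun _ => false)

/-- **The Kronecker number of a bit-vector table, by the index-carrying tree** (a leaf is one `Nat.testBit`). -/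
def goL (L : ℕ) : ℕ → ℕ → ℕ
  | 0, i => (L.testBit i).toNat
  | n + 1, i => goL L n i + KB ^ (4 ^ n) * goL L n (i + 2 ^ n)

/-- The Kronecker number of the table with bit vector `L` — **the literal is forced first** (a `Nat.casesOn` on
`L`): the kernel substitutes the literal itself into the tree, so every node `goL lit n i` is keyed on the literal
and shared between all the spellings of the same restriction bits (`p.1` of the completion pairs); without this,
each spelling re-evaluates the whole tree. -/
def kronL : ℕ → ℕ
  | 0 => goL 0 9 0
  | n + 1 => goL (n + 1) 9 0

/-- `kronL` is the tree on the literal. -/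
lemma kronL_def (L : ℕ) : kronL L = goL L 9 0 := by cases L <;> rfl

/-- The mask: bit `25` of every base-`KB` digit below `4^9`. -/
def mask : ℕ := 2 ^ 25 * ((KB ^ (4 ^ 9) - 1) / (KB - 1))

/-! ## The slices: the digits `j₁, …, j₅` of the edges `9, …, 13` -/

/-- The Kronecker number of the `i`-th table restricted to `(a, b, c, d, e)`, from the literals `L`. -/
def KL (L : Fin 19 → Bool → Bool → Bool → Bool → Bool → ℕ) (i : Fin 19) (a b c d e : Bool) : ℕ :=
  kronL (L i a b c d e)

/-- `S₁ = t4p + t6m` (positive `PD`-group), restricted. -/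
def S1 (L : Fin 19 → Bool → Bool → Bool → Bool → Bool → ℕ) (a b c d e : Bool) : ℕ :=
  KL L 3 a b c d e + KL L 8 a b c d e
/-- `S₂ = t7m0 + t10p` (positive `PD`-group), restricted. -/
def S2 (L : Fin 19 → Bool → Bool → Bool → Bool → Bool → ℕ) (a b c d e : Bool) : ℕ :=
  KL L 12 a b c d e + KL L 15 a b c d e
/-- `S₃ = t7p0 + t10m` (positive `PD`-group), restricted. -/
def S3 (L : Fin 19 → Bool → Bool → Bool → Bool → Bool → ℕ) (a b c d e : Bool) : ℕ :=
  KL L 11 a b c d e + KL L 16 a b c d e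
/-- `S₁′ = t4m + t6p + t11` (negative `PD`-group), restricted. -/
def S1' (L : Fin 19 → Bool → Bool → Bool → Bool → Bool → ℕ) (a b c d e : Bool) : ℕ :=
  KL L 4 a b c d e + KL L 7 a b c d e + KL L 17 a b c d e
/-- `S₂′ = t7p0 + t10m` (negative `PD`-group), restricted. -/
def S2' (L : Fin 19 → Bool → Bool → Bool → Bool → Bool → ℕ) (a b c d e : Bool) : ℕ :=
  KL L 11 a b c d e + KL L 16 a b c d e
/-- `S₃′ = t7m0 + t10p` (negative `PD`-group), restricted. -/
def S3' (L : Fin 19 → Bool → Bool → Bool → Bool → Bool → ℕ) (a b c d e : Bool) : ℕ :=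
  KL L 12 a b c d e + KL L 15 a b c d e

/-- The inner sum of a group at the first factor's bits `(a₁, …, a₅)`: the bracket `f` (of the second and third
factors' bits `(b_i, c_i)` of the edge `8 + i`) summed over the completions of the `a_i` to the digits `j_i` —
edge `13` outermost, edge `9` innermost. -/
def inner (j₁ j₂ j₃ j₄ j₅ : ℕ) (a₁ a₂ a₃ a₄ a₅ : Bool)
    (f : Bool × Bool → Bool × Bool → Bool × Bool → Bool × Bool → Bool × Bool → ℕ) : ℕ :=
  ((Deg3.pairs2 j₅ a₅).map fun p₅ => ((Deg3.pairs2 j₄ a₄).map fun p₄ => ((Deg3.pairs2 j₃ a₃).map fun p₃ =>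
    ((Deg3.pairs2 j₂ a₂).map fun p₂ => ((Deg3.pairs2 j₁ a₁).map fun p₁ =>
      f p₁ p₂ p₃ p₄ p₅).sum).sum).sum).sum).sum

/-- The positive `PD`-group bracket: `Q_b S₁_c + t7p4_b S₂_c + t7m4_b S₃_c`. -/
def brPosPD (L : Fin 19 → Bool → Bool → Bool → Bool → Bool → ℕ) (p₁ p₂ p₃ p₄ p₅ : Bool × Bool) : ℕ :=
  KL L 0 p₁.1 p₂.1 p₃.1 p₄.1 p₅.1 * S1 L p₁.2 p₂.2 p₃.2 p₄.2 p₅.2 +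
    KL L 9 p₁.1 p₂.1 p₃.1 p₄.1 p₅.1 * S2 L p₁.2 p₂.2 p₃.2 p₄.2 p₅.2 +
    KL L 10 p₁.1 p₂.1 p₃.1 p₄.1 p₅.1 * S3 L p₁.2 p₂.2 p₃.2 p₄.2 p₅.2

/-- The positive `PDoU`-group bracket: `t7p4_b t7m5_c + t7m4_b t7p5_c`. -/
def brPosPDoU (L : Fin 19 → Bool → Bool → Bool → Bool → Bool → ℕ) (p₁ p₂ p₃ p₄ p₅ : Bool × Bool) : ℕ :=
  KL L 9 p₁.1 p₂.1 p₃.1 p₄.1 p₅.1 * KL L 14 p₁.2 p₂.2 p₃.2 p₄.2 p₅.2 +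
    KL L 10 p₁.1 p₂.1 p₃.1 p₄.1 p₅.1 * KL L 13 p₁.2 p₂.2 p₃.2 p₄.2 p₅.2

/-- The positive `Q`-group bracket: `PDoU_b t5p_c + t12_b PDoU_c`. -/
def brPosQ (L : Fin 19 → Bool → Bool → Bool → Bool → Bool → ℕ) (p₁ p₂ p₃ p₄ p₅ : Bool × Bool) : ℕ :=
  KL L 2 p₁.1 p₂.1 p₃.1 p₄.1 p₅.1 * KL L 5 p₁.2 p₂.2 p₃.2 p₄.2 p₅.2 +
    KL L 18 p₁.1 p₂.1 p₃.1 p₄.1 p₅.1 * KL L 2 p₁.2 p₂.2 p₃.2 p₄.2 p₅.2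

/-- The negative `PD`-group bracket: `Q_b S₁′_c + t7p4_b S₂′_c + t7m4_b S₃′_c`. -/
def brNegPD (L : Fin 19 → Bool → Bool → Bool → Bool → Bool → ℕ) (p₁ p₂ p₃ p₄ p₅ : Bool × Bool) : ℕ :=
  KL L 0 p₁.1 p₂.1 p₃.1 p₄.1 p₅.1 * S1' L p₁.2 p₂.2 p₃.2 p₄.2 p₅.2 +
    KL L 9 p₁.1 p₂.1 p₃.1 p₄.1 p₅.1 * S2' L p₁.2 p₂.2 p₃.2 p₄.2 p₅.2 +
    KL L 10 p₁.1 p₂.1 p₃.1 p₄.1 p₅.1 * S3' L p₁.2 p₂.2 p₃.2 p₄.2 p₅.2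

/-- The negative `PDoU`-group bracket: `t7p4_b t7p5_c + t7m4_b t7m5_c`. -/
def brNegPDoU (L : Fin 19 → Bool → Bool → Bool → Bool → Bool → ℕ) (p₁ p₂ p₃ p₄ p₅ : Bool × Bool) : ℕ :=
  KL L 9 p₁.1 p₂.1 p₃.1 p₄.1 p₅.1 * KL L 13 p₁.2 p₂.2 p₃.2 p₄.2 p₅.2 +
    KL L 10 p₁.1 p₂.1 p₃.1 p₄.1 p₅.1 * KL L 14 p₁.2 p₂.2 p₃.2 p₄.2 p₅.2

/-- The negative `Q`-group bracket: `PDoU_b t5m_c`. -/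
def brNegQ (L : Fin 19 → Bool → Bool → Bool → Bool → Bool → ℕ) (p₁ p₂ p₃ p₄ p₅ : Bool × Bool) : ℕ :=
  KL L 2 p₁.1 p₂.1 p₃.1 p₄.1 p₅.1 * KL L 6 p₁.2 p₂.2 p₃.2 p₄.2 p₅.2

/-- **The positive slice number**: the Kronecker number of the positive counts of `K₃` at the profiles whose
digits on the edges `9, …, 13` are `j₁, …, j₅`, grouped by the first factor. -/
def kPosS (L : Fin 19 → Bool → Bool → Bool → Bool → Bool → ℕ) (j₁ j₂ j₃ j₄ j₅ : ℕ) : ℕ :=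
  (Deg3.bools.map fun a₅ => (Deg3.bools.map fun a₄ => (Deg3.bools.map fun a₃ => (Deg3.bools.map fun a₂ =>
    (Deg3.bools.map fun a₁ =>
      KL L 1 a₁ a₂ a₃ a₄ a₅ * inner j₁ j₂ j₃ j₄ j₅ a₁ a₂ a₃ a₄ a₅ (brPosPD L) +
        KL L 2 a₁ a₂ a₃ a₄ a₅ * inner j₁ j₂ j₃ j₄ j₅ a₁ a₂ a₃ a₄ a₅ (brPosPDoU L) +
        KL L 0 a₁ a₂ a₃ a₄ a₅ * inner j₁ j₂ j₃ j₄ j₅ a₁ a₂ a₃ a₄ a₅ (brPosQ L)).sum).sum).sum).sum).sum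

/-- **The negative slice number**, grouped the same way. -/
def kNegS (L : Fin 19 → Bool → Bool → Bool → Bool → Bool → ℕ) (j₁ j₂ j₃ j₄ j₅ : ℕ) : ℕ :=
  (Deg3.bools.map fun a₅ => (Deg3.bools.map fun a₄ => (Deg3.bools.map fun a₃ => (Deg3.bools.map fun a₂ =>
    (Deg3.bools.map fun a₁ =>
      KL L 1 a₁ a₂ a₃ a₄ a₅ * inner j₁ j₂ j₃ j₄ j₅ a₁ a₂ a₃ a₄ a₅ (brNegPD L) +
        KL L 2 a₁ a₂ a₃ a₄ a₅ * inner j₁ j₂ j₃ j₄ j₅ a₁ a₂ a₃ a₄ a₅ (brNegPDoU L) +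
        KL L 0 a₁ a₂ a₃ a₄ a₅ * inner j₁ j₂ j₃ j₄ j₅ a₁ a₂ a₃ a₄ a₅ (brNegQ L)).sum).sum).sum).sum).sum

/-- **The slice certificate shape**: `kNegS ≤ kPosS` and the two mask tests. -/
def CertS (L : Fin 19 → Bool → Bool → Bool → Bool → Bool → ℕ) (j₁ j₂ j₃ j₄ j₅ : ℕ) : Prop :=
  kNegS L j₁ j₂ j₃ j₄ j₅ ≤ kPosS L j₁ j₂ j₃ j₄ j₅ ∧
    Nat.land (kPosS L j₁ j₂ j₃ j₄ j₅ - kNegS L j₁ j₂ j₃ j₄ j₅) mask = 0 ∧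
    Nat.land (kNegS L j₁ j₂ j₃ j₄ j₅) mask = 0

/-- **All `1024` slices**: the certificate of a table family. -/
def Cert (L : Fin 19 → Bool → Bool → Bool → Bool → Bool → ℕ) : Prop :=
  ∀ j₁ j₂ j₃ j₄ j₅ : Fin 4, CertS L j₁ j₂ j₃ j₄ j₅

end Five

end Deg4

end Summit.Ventures.PercRepro2
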